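import Literature.IUT.LogThetaLattice.LatticeGlue
import Literature.IUT.LogThetaLattice.RadialDataCore
import Literature.IUT.HodgeArakelov.ThetaGauLinks
import Literature.IUT.HodgeArakelov.TemperedThetaMonoids
import HarnessLib

/-!
# [IUTchIII] Theorem 2.2 (i), (ii) and Corollary 2.3 (ii), (iv): the derivations from the quoted inputs
# (proof-only companion of `ThetaMonoids.lean` / `RadialData.lean` / `FrobeniusPicture.lean`)

S. Mochizuki, *Inter-universal Teichmüller Theory III*, kurims manuscript (May 2020), §2, Theorem 2.2
"(Kummer-compatible Multiradiality of Theta Monoids)" pp. 65–66 and Corollary 2.3 "(Étale-picture of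
Multiradial Theta Monoids)" pp. 72–75, read on the page (`paper:url-4b091feeb646`)
[claim: Mochizuki2012, status: disputed]. Printed proofs (p. 66, p. 75): "The various assertions …
follow immediately from the definitions and the references quoted in the statements of these
assertions." This PROOF-ONLY file (abc-iut cell, D-0068 sub-DAGs `plan/L6/SUBDAG-IUTchIII-Thm-22.md`,
`SUBDAG-IUTchIII-Cor-23.md`; DISCHARGE-L6 §F row F13-b; no new definitions, no typer file edited)
records those derivations in the kernel over the typings of record of abc-iut-L6-t3
(`ThetaMonoidData`, `ThetaCoricData`/`Radial`/`Coric`/`radialAlgorithm`, `etalePicture`,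
`LogThetaLatticeDiagram`, `LatticeGlue`), abc-iut-L6-t2 ([IUTchII] Cor 4.11 (ii) `cor411ii_spokePerm`;
Prop 3.1 (i) `TemperedThetaMonoids.IsSplittingUpToTorsion`) and Mathlib group theory.

What is proved (item by item; "(x.rN)" = the sub-DAG row).

* **Thm 2.2 (i)** (p.65; Thm-22.i.r2–r5): `ThetaMonoidData.thm22_i` — the étale-like line
  `Aut_{F^⊩}(F^⊩_{env}(†D_>)) → Aut_{F^{⊩▶×μ}}(F^{⊩▶×μ}_{env}(†D_>)) ↠ Aut_{F^{⊢×μ}}(F^{⊢×μ}_△(†D^⊢_△))` has a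
  SURJECTIVE second arrow (`autToFxmDelta_surjective`, from the interface field = [IUTchII] Cor 4.10
  (iv) / row F6) and its first arrow is compatible with the Kummer isomorphism of Prop 2.1 (ii)
  (`autToFglxm_kummer`); the Frobenius-like line's second arrow — `Aut(†F^{⊩▶×μ}_{env}) ↠ Aut(†F^{⊢×μ}_△)`,
  i.e. `F^{⊩▶×μ} ↦ F^{⊢×μ}` on automorphisms followed by ANY identification of the resulting strip with
  `†F^{⊢×μ}_△` — is surjective (`thm22_i_frobeniusLike_surjective`), and the second arrows are NATURAL in
  isomorphisms of the input (`mapAut_conjAut`), which is the content of "compatible with the Kummer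
  isomorphisms … and Theorem 1.5, (iii)" for any Kummer transport (`thm22_i_kummerCompatible`).
* **Thm 2.2 (ii)** (pp.65–66; Thm-22.ii.r6, r10–r11, r15–r17): over abstract commutative groups `B`
  (the groupification ambient of `_∞Ψ_{env}(†D_>)_v`, mono-theta side) and `A` (`Ψ^{ss}_{cns}(†F^⊢_△)^×_v`,
  the `F^⊢`-side units) related by ANY homomorphism `κ : B →* A` (the composite of the inverse Kummer
  isomorphism with the natural map to the semi-simplification):
  - (zero map) "each of the various composite maps `_∞Ψ_{env}(†D_>)^μ_v → Ψ^{ss}_{cns}(†F^⊢_△)^{×μ}_v` is equal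
    to the zero map" — `thm22_ii_zeroMap` (the torsion subgroup dies in the `×μ`-quotient);
  - (multiradiality) "the identity automorphism on [(a_v)–(d_v)] is compatible, relative to the various
    natural morphisms involved, with the collection of automorphisms of `Ψ^{ss}_{cns}(†F^⊢_△)^{×μ}_v` induced by
    arbitrary automorphisms ∈ `Aut_{F^{⊢×μ}}(†F^{⊢×μ}_△)`" — `thm22_ii_compatible_id` (the square with `id` on the
    torsion data and ANY endomorphism `β` of the `×μ`-quotient commutes, both composites being trivial);
    every automorphism `α` of `A` does induce an automorphism of `A^{×μ} = A/A^μ` (`torsion_map_mulEquiv`,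
    `mulEquivModTorsion`-free form `thm22_ii_compatible_aut` via `QuotientGroup.congr`);
  - ((d_v), the splittings) over abc-iut-L6-t2's REAL Prop 3.1 (i) predicate: a splitting up to torsion
    `(U, S)` with `B^μ ≤ U` (the torsion lies among the units `M^×_TM`) becomes a DIRECT-PRODUCT
    decomposition in the `×μ`-quotient — the images of `U` and `S` in `B/B^μ` meet trivially
    (`splitting_inf_eq_bot_modTorsion`), cf. [IUTchII] Cor 1.12 (ii) "direct product decompositions inside
    the quotients … by `M^μ_TM(−)`".
* **Cor 2.3 (ii)** (p.74; Cor-23.ii.r3–r7): `cor23_ii_vertical` — the poly-isomorphism of radial data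
  `^{n,m}ℜ ⥲ ^{n,m+1}ℜ` IS the one induced (via `Radial.Hom.ofDHT`) by the Thm 1.5 (i) poly-isomorphism of the
  vertical arrow (which is FULL, `LogThetaLatticeDiagram.vertical_inducedDHT_full`); `cor23_ii_column_iso` /
  `cor23_ii_hub_iso` — all `^{n,m}ℜ` of a column (indeed all radial data) are isomorphic ("`^{n,∘}ℜ` …
  obtained by identifying") and all coric data `Φ(^{n,m}ℜ)` are isomorphic (the hub `^{∘,∘}ℭ`);
  `cor23_ii_spokes` — "arbitrary permutation symmetries among the spokes": for every permutation `σ` of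
  `ℤ` the étale-picture graph automorphism (`etalePicture.spokePerm`, = [IUTchII] Cor 4.11 (ii)
  `cor411ii_spokePerm` DEFINITIONALLY, `cor23_ii_compatible_cor411ii`) together with isomorphisms of coric
  data `Φ(^{σ n,m}ℜ) ≅ Φ(^{n,m}ℜ)` realising it on the data.
* **Cor 2.3 (iv)** (p.75; Cor-23.iv.r13–r17): "stabilized / equivariant / functorial with respect to
  arbitrary automorphisms of the domain and codomain of these horizontal arrows" — `cor23_iv_radial`
  (automorphisms of `†HT^D` act functorially on `†ℜ` and, through `Φ`, on `†ℭ`: `Radial.coreFunctor`,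
  `radialAlgorithm`), `cor23_iv_envToDelta` (the (e_ℜ) full poly-isomorphism is STABILIZED by every such
  automorphism), `cor23_iv_horizontal` (the horizontal identification `horizontalCoricPolyIso` is stable
  under pre- and post-composition with the coric automorphisms induced by automorphisms of the domain /
  codomain `D`-Hodge theaters), plus the record `cor23_iv_thetaMonoid` = abc-iut-L6-t3's
  `ThetaMonoidData.cor23iv_equivariant` for the Kummer-transported theta monoids.

Honest framing. Every statement is bookkeeping over the interfaces `StripFrame`, `ThetaMonoidData`,
`ThetaCoricData`, `LatticeGlue` and abstract commutative groups — typed ≠ discharged for the printed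
objects themselves, which are not constructed here; the [AbsTopIII] Prop 3.2 (iv) input of Cor 2.3
(L4, p410207) is not used by the clauses proved here and is therefore not named. Nothing in this file
asserts a disputed claim or takes a side on [IUTchIII] Cor. 3.12. Deliberately NOT here: Prop 2.1
(ii)–(vi) (row F13-a, `ThetaMonoidsProofs2.lean`), Cor 2.3 (i)/(iii) (row F8,
`EtalePictureThetaProofs.lean`; (i) = `radialAlgorithm_full`/`_essSurj`, (iii) =
`ThetaMonoidData.cor23iii_full` already in the tree).
-/

namespace Literature.IUT.LogThetaLattice

open CategoryTheory
open Literature.IUT.HodgeTheaters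

universe u v

/-! ### 1. Theorem 2.2 (i): automorphisms of prime-strips -/

namespace ThetaMonoidData

variable {S : StripFrame.{u}} (T : ThetaMonoidData S)

/-- **IUTchIII:Thm2.2(i)** (kurims p.65) CLOSING THEOREM for the étale-like line
`Aut_{F^⊩}(F^⊩_{env}(†D_>)) → Aut_{F^{⊩▶×μ}}(F^{⊩▶×μ}_{env}(†D_>)) ↠ Aut_{F^{⊢×μ}}(F^{⊢×μ}_△(†D^⊢_△))`: "the second
arrows in each line are surjections" (⟸ Prop 2.1 (vi) + [IUTchII] Cor 4.10 (iv), the interface field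
`mapAut_surjective`; row Thm-22.i.r4) AND the first arrow is "compatible with the Kummer isomorphisms of
Proposition 2.1, (ii)" (row Thm-22.i.r2) — the conjunction of abc-iut-L6-t3's two tree theorems.
[claim: Mochizuki2012, status: disputed] -/
theorem thm22_i (H : S.DHT) (X : S.HT) :
    Function.Surjective (T.autToFxmDelta H) ∧
      ∀ a : Aut (T.FglEnvHT.obj X),
        T.autToFglxm _ (Iso.conjAut (T.kummerFglAt X) a) =
          Iso.conjAut (S.FglToFglxm.mapIso (T.kummerFglAt X)) (T.autToFglxmHT X a) :=
  ⟨T.autToFxmDelta_surjective H, T.autToFglxm_kummer X⟩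

/-- **IUTchIII:Thm2.2(i)** (kurims p.65) NATURALITY of "the natural functor … assigning to an
`F^{⊩▶×μ}`-prime-strip the associated `F^{⊢×μ}`-prime-strip" on automorphism groups: transporting an
automorphism along an isomorphism `κ` of `F^{⊩▶×μ}`-prime-strips and then passing to `F^{⊢×μ}` = passing to
`F^{⊢×μ}` and transporting along `F^{⊢×μ}(κ)`. This is the mechanism of every "compatible with the Kummer
isomorphisms" clause of (i) (rows Thm-22.i.r2, r5). [claim: Mochizuki2012, status: disputed] -/
theorem mapAut_conjAut {X₁ X₂ : S.Fglxm} (κ : X₁ ≅ X₂) (a : Aut X₁) :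
    S.FglxmToFxm.mapAut X₂ (Iso.conjAut κ a) =
      Iso.conjAut (S.FglxmToFxm.mapIso κ) (S.FglxmToFxm.mapAut X₁ a) := by
  rw [Iso.conjAut_apply, Iso.conjAut_apply]
  show S.FglxmToFxm.mapIso (_ ≪≫ a ≪≫ _) = _ ≪≫ S.FglxmToFxm.mapIso a ≪≫ _
  rw [Functor.mapIso_trans, Functor.mapIso_trans, Functor.mapIso_symm]

/-- **IUTchIII:Thm2.2(i)** (kurims p.65) the Frobenius-like line's second arrow
`Aut_{F^{⊩▶×μ}}(†F^{⊩▶×μ}_{env}) ↠ Aut_{F^{⊢×μ}}(†F^{⊢×μ}_△)` — `F^{⊩▶×μ} ↦ F^{⊢×μ}` on automorphisms followed by the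
identification `e` of the resulting `F^{⊢×μ}`-prime-strip with `†F^{⊢×μ}_△` ([IUTchII] Cor 4.10 (iv): the
natural isomorphism `†F^{⊢×μ}_△ ⥲ †F^{⊢×μ}_{env}`; stated for ANY `e`) — IS SURJECTIVE ("the second arrows in each
line are surjections"; row Thm-22.i.r4). [claim: Mochizuki2012, status: disputed] -/
theorem thm22_i_frobeniusLike_surjective (X : S.HT) {Y : S.Fxm}
    (e : S.FglxmToFxm.obj (S.FglToFglxm.obj (T.FglEnvHT.obj X)) ≅ Y) :
    Function.Surjective ((Iso.conjAut e).toMonoidHom.comp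
      (S.FglxmToFxm.mapAut (S.FglToFglxm.obj (T.FglEnvHT.obj X)))) :=
  (Iso.conjAut e).surjective.comp (T.mapAut_surjective _)

/-- **IUTchIII:Thm2.2(i)** (kurims p.65) "compatible with the Kummer isomorphisms of Proposition 2.1, (ii),
and Theorem 1.5, (iii)" for the SECOND arrows (rows Thm-22.i.r2, r5): transporting an automorphism of
`†F^{⊩▶×μ}_{env}` along the Kummer isomorphism `†F^{⊩▶×μ}_{env} ⥲ F^{⊩▶×μ}_{env}(†D_>)` (`F^{⊩▶×μ}` of `kummerFglAt`)
and then applying the étale-like second arrow `autToFxmDelta` = applying `F^{⊩▶×μ} ↦ F^{⊢×μ}` and then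
transporting along the induced isomorphism of `F^{⊢×μ}`-prime-strips followed by the Prop 2.1 (vi)
identification `unitPortionD` (any further Kummer identification of the target, e.g. the Thm 1.5 (iii)
isomorphism `†F^{⊢×μ}_△ ⥲ F^{⊢×μ}_△(†D^⊢_△)`, composes on both sides by `Iso.trans_conjAut`).
[claim: Mochizuki2012, status: disputed] -/
theorem thm22_i_kummerCompatible (X : S.HT) (a : Aut (S.FglToFglxm.obj (T.FglEnvHT.obj X))) :
    T.autToFxmDelta (S.htToD.obj X) (Iso.conjAut (S.FglToFglxm.mapIso (T.kummerFglAt X)) a) =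
      Iso.conjAut (S.FglxmToFxm.mapIso (S.FglToFglxm.mapIso (T.kummerFglAt X)) ≪≫
          (T.unitPortionD.app (S.htToD.obj X)).symm)
        (S.FglxmToFxm.mapAut _ a) := by
  rw [Iso.trans_conjAut, ← mapAut_conjAut (S := S)]
  rfl

end ThetaMonoidData

/-! ### 2. Theorem 2.2 (ii): Kummer aspects of multiradiality at bad primes -/

section Thm22ii

variable {B A : Type*} [CommGroup B] [CommGroup A]

/-- **IUTchIII:Thm2.2(ii)** (kurims p.66) "each of the various composite maps
`_∞Ψ_{env}(†D_>)^μ_v → Ψ^{ss}_{cns}(†F^⊢_△)^{×μ}_v` is equal to the zero map [cf. (b_v); the final portion of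
Proposition 2.1, (iii)]" (row Thm-22.ii.r6/r15): for ANY homomorphism `κ : B →* A` from (the
groupification ambient of) `_∞Ψ_{env}(†D_>)_v` to the `F^⊢`-side units `Ψ^{ss}_{cns}(†F^⊢_△)^×_v` — in print the
inverse Kummer isomorphism of Prop 2.1 (ii) followed by the natural surjection/isomorphism of the
diagram — the composite `B^μ ⊆ B → A ↠ A^{×μ} = A/A^μ` is trivial. [claim: Mochizuki2012, status: disputed] -/
theorem thm22_ii_zeroMap (κ : B →* A) :
    (QuotientGroup.mk' (CommGroup.torsion A)).comp (κ.comp (CommGroup.torsion B).subtype) = 1 :=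
  torsionSubgroup_comp_mkTorsionQuotient (κ.comp (CommGroup.torsion B).subtype)

/-- **IUTchIII:Thm2.2(ii)** (kurims p.66) pointwise form of the zero map: every torsion element of the
mono-theta side has trivial image in `Ψ^{ss}_{cns}(†F^⊢_△)^{×μ}_v`. [claim: Mochizuki2012, status: disputed] -/
theorem thm22_ii_zeroMap_apply (κ : B →* A) (x : B) (hx : x ∈ CommGroup.torsion B) :
    (QuotientGroup.mk' (CommGroup.torsion A)) (κ x) = 1 := by
  have h := congrArg (fun φ : CommGroup.torsion B →* A ⧸ CommGroup.torsion A => φ ⟨x, hx⟩)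
    (thm22_ii_zeroMap (B := B) κ)
  simpa using h

/-- **IUTchIII:Thm2.2(ii)** (kurims p.66) "the identity automorphism on the following objects
[(a_v) `_∞Ψ^⊥_{env}(†D_>)_v ⊇ _∞Ψ_{env}(†D_>)^μ_v`; (b_v) `Π_μ(M^Θ_*(†D_{>,v})) ⊗ ℚ/ℤ ⥲ _∞Ψ_{env}(†D_>)^μ_v`; (c_v); (d_v)]
is compatible, relative to the various natural morphisms involved, with the collection of
automorphisms of `Ψ^{ss}_{cns}(†F^⊢_△)^{×μ}_v` induced by arbitrary automorphisms ∈ `Aut_{F^{⊢×μ}}(†F^{⊢×μ}_△)`"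
(row Thm-22.ii.r6): since the only map from the torsion data to `Ψ^{ss}_{cns}(†F^⊢_△)^{×μ}_v` is the ZERO map,
the square `(id on B^μ, β on A^{×μ})` commutes for EVERY endomorphism `β` of `A^{×μ}` — in particular for
those induced by `Aut_{F^{⊢×μ}}(†F^{⊢×μ}_△)`. [claim: Mochizuki2012, status: disputed] -/
theorem thm22_ii_compatible_id (κ : B →* A) (β : A ⧸ CommGroup.torsion A →* A ⧸ CommGroup.torsion A) :
    β.comp ((QuotientGroup.mk' (CommGroup.torsion A)).comp (κ.comp (CommGroup.torsion B).subtype)) =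
      ((QuotientGroup.mk' (CommGroup.torsion A)).comp (κ.comp (CommGroup.torsion B).subtype)).comp
        (MonoidHom.id _) := by
  rw [thm22_ii_zeroMap, MonoidHom.comp_one, MonoidHom.one_comp]

/-- **IUTchIII:Thm2.2(ii)** (kurims p.66) "the superscript "`μ`" denotes the torsion subgroup; … the
superscript "`×μ`" denotes the quotient `(−)^×/(−)^μ`": the torsion subgroup is CHARACTERISTIC — every
automorphism `α` of `A` (e.g. the one induced on `Ψ^{ss}_{cns}(†F^⊢_△)^×_v` by an automorphism of the
`F^{⊢×μ}`-prime-strip `†F^{⊢×μ}_△`) maps `A^μ` onto itself … [claim: Mochizuki2012, status: disputed] -/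
theorem torsion_map_mulEquiv (α : A ≃* A) :
    (CommGroup.torsion A).map (α : A →* A) = CommGroup.torsion A := by
  ext y
  simp only [Subgroup.mem_map, CommGroup.mem_torsion, MonoidHom.coe_coe]
  constructor
  · rintro ⟨x, hx, rfl⟩
    exact α.toMonoidHom.isOfFinOrder hx
  · intro hy
    exact ⟨α.symm y, α.symm.toMonoidHom.isOfFinOrder hy, α.apply_symm_apply y⟩

/-- **IUTchIII:Thm2.2(ii)** (kurims p.66) … hence induces an automorphism of `A^{×μ}` (Mathlib
`QuotientGroup.congr`), and the compatibility of (a_v)–(d_v) with it is `thm22_ii_compatible_id` for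
`β :=` that induced automorphism: explicitly, for every `α ∈ Aut(A)` and every torsion element `x` of the
mono-theta side, `ᾱ` fixes the (trivial) image of `x`. [claim: Mochizuki2012, status: disputed] -/
theorem thm22_ii_compatible_aut (κ : B →* A) (α : A ≃* A) (x : B) (hx : x ∈ CommGroup.torsion B) :
    QuotientGroup.congr (CommGroup.torsion A) (CommGroup.torsion A) α (torsion_map_mulEquiv α)
        ((QuotientGroup.mk' (CommGroup.torsion A)) (κ x)) =
      (QuotientGroup.mk' (CommGroup.torsion A)) (κ x) := by
  rw [thm22_ii_zeroMap_apply κ x hx, map_one]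

/-- **IUTchIII:Thm2.2(ii)** (kurims p.65) (d_v) "the splittings `_∞Ψ^⊥_{env}(†D_>)_v ↠ _∞Ψ_{env}(†D_>)^μ_v` … by
means of restriction to zero-labeled evaluation points [cf. [IUTchII], Proposition 3.1, (i)]" at the
level of abc-iut-L6-t2's REAL Prop 3.1 (i) predicate `IsSplittingUpToTorsion U S` ("`U ∩ S` consists of
torsion elements", `U = M^×_TM ⊇ B^μ`, `S = ∞θ^ι_{env}(M^Θ_*)^ℕ`): in the `×μ`-quotient the splitting becomes a
DIRECT-PRODUCT decomposition — the images of `U` and `S` in `B/B^μ` intersect trivially ([IUTchII] Cor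
1.12 (ii): "direct product decompositions inside the quotients … by `M^μ_TM(−)`").
[claim: Mochizuki2012, status: disputed] -/
theorem splitting_inf_eq_bot_modTorsion {U : Subgroup B} {M : Submonoid B}
    (h : Literature.IUT.HodgeArakelov.TemperedThetaMonoids.IsSplittingUpToTorsion U M)
    (hμ : CommGroup.torsion B ≤ U) :
    (U.map (QuotientGroup.mk' (CommGroup.torsion B)) : Set (B ⧸ CommGroup.torsion B)) ∩
        (QuotientGroup.mk' (CommGroup.torsion B)) '' (M : Set B) = {1} := by
  ext y
  simp only [Set.mem_inter_iff, SetLike.mem_coe, Subgroup.mem_map, Set.mem_image,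
    Set.mem_singleton_iff]
  constructor
  · rintro ⟨⟨u, hu, rfl⟩, s, hs, hsu⟩
    -- `mk s = mk u`, so `t := s⁻¹ * u` is torsion, hence lies in `U`; so `s = u * t⁻¹ ∈ U ∩ M` is torsion
    have ht : s⁻¹ * u ∈ CommGroup.torsion B := by
      rw [← QuotientGroup.eq]
      exact hsu
    have hsU : s ∈ U := by
      have hs' : s = u * (s⁻¹ * u)⁻¹ := by rw [mul_inv_rev, inv_inv, mul_inv_cancel_left]
      rw [hs']
      exact U.mul_mem hu (U.inv_mem (hμ ht))
    have hfin : IsOfFinOrder s := h.inter_torsion s hsU hs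
    rw [← hsu]
    exact (QuotientGroup.eq_one_iff s).mpr hfin
  · rintro rfl
    exact ⟨⟨1, U.one_mem, map_one _⟩, 1, M.one_mem, map_one _⟩

/-- **IUTchIII:Thm2.2(ii)** (kurims p.65) (d_v) at abc-iut-L6-t2's REAL mono-theta-theoretic theta
monoids ([IUTchII] Prop 3.1 (i), `TemperedThetaMonoids.ThetaEnvData`; rows Thm-22.ii.r10/r11): given the
Prop 3.1 statements `Prop31Statements E` (their `splitting` clause: "splittings up to torsion determined
by the subsets `M^×_TM(M^Θ_*)`, `∞θ^ι_{env}(M^Θ_*)`") and the printed inclusion `_∞Ψ^μ ⊆ _∞Ψ^×` of the diagram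
of Thm 2.2 (ii) (the torsion subgroup lies among the units `M^×_TM`, hypothesis `hμ`), the unit part and
the `∞θ^ι_{env}`-part meet trivially in the `×μ`-quotient, for every `ι`. [claim: Mochizuki2012, status: disputed] -/
theorem thm22_ii_splitting_of_prop31 {P : Type u} [Group P]
    (E : Literature.IUT.HodgeArakelov.TemperedThetaMonoids.ThetaEnvData.{u, v} P)
    (hP : Literature.IUT.HodgeArakelov.TemperedThetaMonoids.Prop31Statements E)
    (hμ : CommGroup.torsion E.H ≤ E.units) (ι : E.Iota) :
    (E.units.map (QuotientGroup.mk' (CommGroup.torsion E.H)) : Set (E.H ⧸ CommGroup.torsion E.H)) ∩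
        (QuotientGroup.mk' (CommGroup.torsion E.H)) ''
          (Submonoid.closure (E.inftyThetaEnv ι) : Set E.H) = {1} :=
  splitting_inf_eq_bot_modTorsion (hP.splitting ι) hμ

end Thm22ii

/-! ### 3. Corollary 2.3 (ii): the radial data of the lattice and the étale-picture -/

section Cor23ii

variable {S : StripFrame.{u}} (E : ThetaCoricData S)

/-- **IUTchIII:Cor2.3(ii)** (kurims p.74) "the poly-isomorphisms induced by the vertical arrows of the
Gaussian log-theta-lattice [cf. Theorem 1.5, (i)] induce poly-isomorphisms of radial data
`… ⥲ ^{n,m}ℜ ⥲ ^{n,m+1}ℜ ⥲ …`" (rows Cor-23.ii.r5): abc-iut-L6-t3's `verticalRadialPolyIso` (all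
`Radial.Hom.ofDHT ξ`) IS the image under `ξ ↦ (ξ, F^{⊢×μ}_△(D^⊢_△(ξ)))` of the poly-isomorphism
`^{n,m}HT^D ⥲ ^{n,m+1}HT^D` induced by the vertical arrow of a log-theta-lattice `Λ` — which is the FULL
poly-isomorphism by Thm 1.5 (i) (`LogThetaLatticeDiagram.vertical_inducedDHT_full`).
[claim: Mochizuki2012, status: disputed] -/
theorem cor23_ii_vertical {L : LogStripData S} {T : ThetaLinkData S} (Λ : LogThetaLatticeDiagram L T)
    (n m : ℤ) :
    verticalRadialPolyIso E (fun p => S.htToD.obj (Λ.HT p)) n m =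
      (fun ξ : S.htToD.obj (Λ.HT (n, m)) ≅ S.htToD.obj (Λ.HT (n, m + 1)) =>
        Radial.Hom.ofDHT (E := E) (R := latticeRadial E (fun p => S.htToD.obj (Λ.HT p)) (n, m))
          (R' := latticeRadial E (fun p => S.htToD.obj (Λ.HT p)) (n, m + 1)) ξ) ''
        (Λ.vertical n m).inducedDHT := by
  rw [LogThetaLatticeDiagram.vertical_inducedDHT_full]
  show Set.range _ = _ '' Set.univ
  exact Set.image_univ.symm

/-- **IUTchIII:Cor2.3(ii)** (kurims p.74) every constituent of the vertical poly-isomorphism of radial data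
is an isomorphism of radial data (`ℜ` is a groupoid, [IUTchII] Ex 1.7 (i)), and it is nonempty — so
"`^{n,∘}ℜ` … the radial data obtained by identifying the various `^{n,m}ℜ`, for `m ∈ ℤ`, via these
poly-isomorphisms" is well-defined up to isomorphism: ALL `^{n,m}ℜ` of the `n`-th column (indeed any two
radial data) are isomorphic (row Cor-23.ii.r5). [claim: Mochizuki2012, status: disputed] -/
theorem cor23_ii_column_iso (H : ℤ × ℤ → S.DHT) (n m m' : ℤ) :
    Nonempty (latticeRadial E H (n, m) ≅ latticeRadial E H (n, m')) :=
  ⟨(Groupoid.isoEquivHom _ _).symm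
    (Radial.Hom.ofDHT (R := latticeRadial E H (n, m)) (R' := latticeRadial E H (n, m'))
      (S.iso_nonempty_DHT _ _).some)⟩

/-- **IUTchIII:Cor2.3(ii)** (kurims p.74) "Write `^{∘,∘}ℭ` for the coric data obtained by identifying the
various `^{n,∘}ℭ`, for `n ∈ ℤ`, via these [horizontal, Theorem 1.5, (ii)] poly-isomorphisms" — well-defined
up to isomorphism: the coric data `Φ(^{n,m}ℜ)` at ALL lattice points are isomorphic (the single hub of
Fig. 2.4; rows Cor-23.ii.r4, r6). [claim: Mochizuki2012, status: disputed] -/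
theorem cor23_ii_hub_iso (H : ℤ × ℤ → S.DHT) (p q : ℤ × ℤ) :
    Nonempty ((radialAlgorithm E).obj (latticeRadial E H p) ≅
      (radialAlgorithm E).obj (latticeRadial E H q)) :=
  ⟨(radialAlgorithm E).mapIso ((Groupoid.isoEquivHom _ _).symm
    (Radial.Hom.ofDHT (R := latticeRadial E H p) (R' := latticeRadial E H q)
      (S.iso_nonempty_DHT _ _).some))⟩

/-- **IUTchIII:Cor2.3(ii)** (kurims p.74) "this diagram satisfies the important property of admitting
arbitrary permutation symmetries among the spokes [i.e., the labels `n ∈ ℤ` of the radial data]"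
(row Cor-23.ii.r3): for every permutation `σ` of `ℤ`, the étale-picture graph automorphism
(`etalePicture.spokePerm`) moves the spoke `n` to `σ n` and fixes the hub, AND it is realised on the
data: the coric data of the spokes `σ n` and `n` are isomorphic for every `n` (any row `m`).
[claim: Mochizuki2012, status: disputed] -/
theorem cor23_ii_spokes (H : ℤ × ℤ → S.DHT) (m : ℤ) (σ : Equiv.Perm ℤ) :
    (∀ n : ℤ, etalePicture.spokePerm σ (some n) = some (σ n)) ∧
      etalePicture.spokePerm σ (none : Option ℤ) = none ∧
        ∀ n : ℤ, Nonempty ((radialAlgorithm E).obj (latticeRadial E H (σ n, m)) ≅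
          (radialAlgorithm E).obj (latticeRadial E H (n, m))) :=
  ⟨fun _ => rfl, rfl, fun n => cor23_ii_hub_iso E H (σ n, m) (n, m)⟩

/-- **IUTchIII:Cor2.3(ii)** (kurims p.74) "[cf. the situation discussed in [IUTchII], Corollary 4.11,
(ii)]" (row Cor-23.ii.r3): the étale-picture of Cor 2.3 (ii) and the étale-picture of [IUTchII] Cor 4.11
(ii) are the SAME star graph on `Option ℤ`, and abc-iut-L6-t2's `cor411ii_spokePerm` is literally
abc-iut-L6-t3's `etalePicture.spokePerm` — the compatibility is definitional.
[claim: Mochizuki2012, status: disputed] -/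
theorem cor23_ii_compatible_cor411ii (σ : Equiv.Perm ℤ) :
    Literature.IUT.HodgeArakelov.cor411ii_spokePerm σ = etalePicture.spokePerm σ := rfl

end Cor23ii

/-! ### 4. Corollary 2.3 (iv): equivariance with respect to automorphisms of the horizontal arrows' ends -/

section Cor23iv

variable {S : StripFrame.{u}} (E : ThetaCoricData S)

/-- **IUTchIII:Cor2.3(iv)** (kurims p.75) "stabilized/equivariant/functorial with respect to arbitrary
automorphisms of the domain and codomain [`D`-Hodge theaters] of these horizontal arrows" (rows
Cor-23.iv.r13–r15): automorphisms `α, β` of `†HT^D` act on the radial datum `†ℜ` (`Radial.Hom.ofDHT`) and,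
through the radial algorithm `Φ`, on the coric datum `†ℭ`, FUNCTORIALLY (composition is respected on
both levels). [claim: Mochizuki2012, status: disputed] -/
theorem cor23_iv_radial (R : Radial E) (α β : R.ht ≅ R.ht) :
    Radial.Hom.ofDHT (R := R) (R' := R) (α ≪≫ β) =
        Radial.Hom.ofDHT (R := R) (R' := R) α ≫ Radial.Hom.ofDHT (R := R) (R' := R) β ∧
      (radialAlgorithm E).map (Radial.Hom.ofDHT (R := R) (R' := R) (α ≪≫ β)) =
        (radialAlgorithm E).map (Radial.Hom.ofDHT (R := R) (R' := R) α) ≫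
          (radialAlgorithm E).map (Radial.Hom.ofDHT (R := R) (R' := R) β) := by
  have h : Radial.Hom.ofDHT (R := R) (R' := R) (α ≪≫ β) =
      Radial.Hom.ofDHT (R := R) (R' := R) α ≫ Radial.Hom.ofDHT (R := R) (R' := R) β := by
    apply Radial.hom_ext
    · rfl
    · show E.fxmOfDv.mapIso (E.dvDelta.mapIso (α ≪≫ β)) = _
      rw [Functor.mapIso_trans, Functor.mapIso_trans]
      rfl
  exact ⟨h, by rw [h, Functor.map_comp]⟩

/-- **IUTchIII:Cor2.3(iv)** (kurims p.75) the (e_ℜ) poly-isomorphism `F^{⊢×μ}_{env}(†D_>) ⥲ F^{⊢×μ}_△(†D^⊢_△)` is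
STABILIZED by every automorphism `α` of `†HT^D`: conjugating it by the induced isomorphisms
`F^{⊢×μ}_{env}(D_>(α))` and `F^{⊢×μ}_△(D^⊢_△(α))` returns it (row Cor-23.iv.r13/r14, via (e_{Morℜ})).
[claim: Mochizuki2012, status: disputed] -/
theorem cor23_iv_envToDelta (R : Radial E) (α : R.ht ≅ R.ht) :
    ((PolyIso.single (E.fxmEnv.mapIso α).symm).comp R.envToDelta).comp
        (PolyIso.single (Radial.Hom.ofDHT (R := R) (R' := R) α).δ) = R.envToDelta :=
  Radial.Hom.compatible_envToDelta (Radial.Hom.ofDHT (R := R) (R' := R) α) (E.fxmEnv.mapIso α)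

/-- **IUTchIII:Cor2.3(iv)** (kurims p.75) the HORIZONTAL identification of coric data (all morphisms of coric
data induced by isomorphisms `^{n,m}D^⊢_△ ⥲ ^{n+1,m}D^⊢_△`, `horizontalCoricPolyIso`; Thm 1.5 (ii)) is STABLE
under pre-composition with the coric automorphisms induced by automorphisms `α` of the DOMAIN `D`-Hodge
theater and post-composition with those induced by automorphisms `β` of the CODOMAIN (rows
Cor-23.iv.r15, r17). [claim: Mochizuki2012, status: disputed] -/
theorem cor23_iv_horizontal (H : ℤ × ℤ → S.DHT) (n m : ℤ) (α : H (n, m) ≅ H (n, m))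
    (β : H (n + 1, m) ≅ H (n + 1, m))
    {f : (radialAlgorithm E).obj (latticeRadial E H (n, m)) ⟶
      (radialAlgorithm E).obj (latticeRadial E H (n + 1, m))}
    (hf : f ∈ horizontalCoricPolyIso E H n m) :
    (radialAlgorithm E).map
          (Radial.Hom.ofDHT (R := latticeRadial E H (n, m)) (R' := latticeRadial E H (n, m)) α) ≫
        f ≫ (radialAlgorithm E).map
          (Radial.Hom.ofDHT (R := latticeRadial E H (n + 1, m)) (R' := latticeRadial E H (n + 1, m)) β) ∈
      horizontalCoricPolyIso E H n m := by
  obtain ⟨d, rfl⟩ := hf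
  refine ⟨E.dvDelta.mapIso α ≪≫ d ≪≫ E.dvDelta.mapIso β, ?_⟩
  apply Coric.hom_ext
  · show E.dvDelta.mapIso α ≪≫ d ≪≫ E.dvDelta.mapIso β =
      Radial.Hom.inducedDv E (Radial.Hom.ofDHT (R := latticeRadial E H (n, m))
          (R' := latticeRadial E H (n, m)) α) ≪≫ d ≪≫
        Radial.Hom.inducedDv E (Radial.Hom.ofDHT (R := latticeRadial E H (n + 1, m))
          (R' := latticeRadial E H (n + 1, m)) β)
    exact (congrArg₂ (fun x y => x ≪≫ d ≪≫ y)
      (Radial.inducedDv_ofDHT E (R := latticeRadial E H (n, m)) (R' := latticeRadial E H (n, m)) α)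
      (Radial.inducedDv_ofDHT E (R := latticeRadial E H (n + 1, m))
        (R' := latticeRadial E H (n + 1, m)) β)).symm
  · show E.fxmOfDv.mapIso (E.dvDelta.mapIso α ≪≫ d ≪≫ E.dvDelta.mapIso β) =
      E.fxmOfDv.mapIso (E.dvDelta.mapIso α) ≪≫ E.fxmOfDv.mapIso d ≪≫
        E.fxmOfDv.mapIso (E.dvDelta.mapIso β)
    rw [Functor.mapIso_trans, Functor.mapIso_trans]

/-- **IUTchIII:Cor2.3(iv)** (kurims p.75) "the algorithmic constructions of … Proposition 2.1, Theorem 2.2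
… are stabilized/equivariant/functorial with respect to arbitrary automorphisms": for the étale-like
outputs of Prop 2.1 (i) — the vertically coric theta monoids `Ψ_{env}(†D_>)`, `_∞Ψ_{env}(†D_>)` and the
realified Frobenioid `D^⊩_{env}(†D^⊢_>)` — transport along `α ≪≫ β` is transport along `α` then `β`
(functoriality; abc-iut-L6-t3's `cor23iv_equivariant` is the first clause). [claim: Mochizuki2012, status: disputed] -/
theorem cor23_iv_thetaMonoid (T : ThetaMonoidData S) (X : S.DHT) (α β : X ≅ X) :
    (T.Dgt ⋙ T.ΨenvD).mapIso (α ≪≫ β) = (T.Dgt ⋙ T.ΨenvD).mapIso α ≪≫ (T.Dgt ⋙ T.ΨenvD).mapIso β ∧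
      (T.Dgt ⋙ T.ΨenvInfD).mapIso (α ≪≫ β) =
          (T.Dgt ⋙ T.ΨenvInfD).mapIso α ≪≫ (T.Dgt ⋙ T.ΨenvInfD).mapIso β ∧
        (T.Dgt ⋙ S.DToDv ⋙ T.DglEnv).mapIso (α ≪≫ β) =
          (T.Dgt ⋙ S.DToDv ⋙ T.DglEnv).mapIso α ≪≫ (T.Dgt ⋙ S.DToDv ⋙ T.DglEnv).mapIso β :=
  ⟨T.cor23iv_equivariant X α β, Functor.mapIso_trans _ _ _, Functor.mapIso_trans _ _ _⟩

end Cor23iv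



end Literature.IUT.LogThetaLattice
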